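import Summits.AtomisticToContinuum.Crystallization.Theses.SquareWellLayerCake

/-!
# `AveragedTwelve` (crux stmt-AtomisticToContinuum-15806, route `SquareWellLayerCake`), negative side I:
# load-bearing hypotheses, the integer-coordinate refutation shape, and the pointwise strengthening

(refuter, cdisprove seat, cycle 1; nothing is defined and no notation is declared — every statement
is spelled out; the finite witness enters the proofs as an explicit matrix literal.)

Write `A(c)` for the crux with ratio constant `c`:
`∀ N (x : Fin N → ℝ³) (G : Finset (Fin N)) (d ρ : ℝ), 0 < d → ρ ≤ c·d → (G pairwise ≥ d apart) →
 Σ_{i ∈ G} #{j ∈ G, j ≠ i, dist (x i) (x j) ≤ ρ} ≤ 12·|G|`; the crux is `A(57/50)`.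

* LOAD-BEARING: each hypothesis dropped in turn makes the statement false by a trivial witness —
  `averagedTwelve_false_without_pos` (no `0 < d`: 14 coincident points, `d = ρ = 0`),
  `averagedTwelve_false_without_sep` (no separation: 14 coincident points, `d = 1`),
  `averagedTwelve_false_without_ratio` (no `ρ ≤ c·d`: 14 collinear points at unit spacing, `ρ = 13`).
* REFUTATION SHAPE `not_averagedTwelveAt_of_intConfig`: integer coordinates, squared separation `D`,
  integer radius `M ≤ c·√D`, and `> 12 N` ordered pairs at squared distance `≤ M²` refute `A(c)`;
  all hypotheses but `M ≤ c·√D` are decidable integer facts (this is how the bcc tightness witness at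
  `c = 2/√3` and any future counterexample at `c = 57/50` are certified).
* POINTWISE STRENGTHENING IS FALSE at `57/50` (`not_averagedTwelve_pointwise`): one centre with 14
  neighbours (bicapped staggered hexagonal arrangement, integer coordinates, `D = 389`, `M = 22`;
  Tammes: 13/14/15/16 neighbours fit from ratios 1.0456/1.0709/1.108/1.1356).  Every one-centre
  argument proves the pointwise form, so any proof of the crux must genuinely average over centres
  (`averaged_of_pointwise` records that the pointwise form does imply the averaged one).
This file does NOT refute the crux.  All `[folklore]`.
-/

namespace Summit.AtomisticToContinuum.Crystallization.Theorems.AveragedTwelveNegative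

open scoped BigOperators

/-! ## §1 Load-bearing hypotheses -/

/-- With all `N` points coincident every point has `N - 1` neighbours at distance `0 ≤ ρ`. [folklore] -/
theorem sum_card_coincident (N : ℕ) (ρ : ℝ) (hρ : 0 ≤ ρ) :
    (∑ i ∈ (Finset.univ : Finset (Fin N)),
      (((Finset.univ : Finset (Fin N)).filter fun j => j ≠ i ∧
        dist (0 : EuclideanSpace ℝ (Fin 3)) (0 : EuclideanSpace ℝ (Fin 3)) ≤ ρ).card : ℝ))
      = N * ((N - 1 : ℕ) : ℝ) := by
  have h : ∀ i : Fin N, ((Finset.univ : Finset (Fin N)).filter fun j => j ≠ i ∧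
        dist (0 : EuclideanSpace ℝ (Fin 3)) (0 : EuclideanSpace ℝ (Fin 3)) ≤ ρ) = Finset.univ.erase i := by
    intro i
    ext j
    simp [hρ, Finset.mem_erase]
  simp_rw [h, Finset.card_erase_of_mem (Finset.mem_univ _), Finset.card_univ, Fintype.card_fin]
  simp [Finset.sum_const, Finset.card_univ, Fintype.card_fin]

/-- LOAD-BEARING `0 < d`: with the positivity of `d` dropped the crux is false
(`d = ρ = 0`, fourteen coincident points have 13 > 12 neighbours each). [folklore] -/
theorem averagedTwelve_false_without_pos :
    ¬ (∀ (N : ℕ) (x : Fin N → EuclideanSpace ℝ (Fin 3)) (G : Finset (Fin N)) (d ρ : ℝ),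
        ρ ≤ 57 / 50 * d → (∀ i ∈ G, ∀ j ∈ G, i ≠ j → d ≤ dist (x i) (x j)) →
        (∑ i ∈ G, ((G.filter fun j => j ≠ i ∧ dist (x i) (x j) ≤ ρ).card : ℝ)) ≤ 12 * G.card) := by
  intro H
  have h := H 14 (fun _ => 0) Finset.univ 0 0 (by norm_num) (by intro i _ j _ _; exact dist_nonneg)
  beta_reduce at h
  rw [sum_card_coincident 14 0 le_rfl] at h
  simp at h
  norm_num at h

/-- LOAD-BEARING separation: with the separation hypothesis dropped the crux is false
(fourteen coincident points, `d = 1`, `ρ = 57/50`). [folklore] -/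
theorem averagedTwelve_false_without_sep :
    ¬ (∀ (N : ℕ) (x : Fin N → EuclideanSpace ℝ (Fin 3)) (G : Finset (Fin N)) (d ρ : ℝ),
        0 < d → ρ ≤ 57 / 50 * d →
        (∑ i ∈ G, ((G.filter fun j => j ≠ i ∧ dist (x i) (x j) ≤ ρ).card : ℝ)) ≤ 12 * G.card) := by
  intro H
  have h := H 14 (fun _ => 0) Finset.univ 1 (57 / 50) (by norm_num) (by norm_num)
  beta_reduce at h
  rw [sum_card_coincident 14 (57 / 50) (by norm_num)] at h
  simp at h
  norm_num at h

/-- Distances between the collinear points `(i, 0, 0)` are differences of indices. [folklore] -/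
theorem dist_collinear (i j : Fin 14) :
    dist (WithLp.toLp 2 ![((i : ℕ) : ℝ), 0, 0] : EuclideanSpace ℝ (Fin 3))
         (WithLp.toLp 2 ![((j : ℕ) : ℝ), 0, 0] : EuclideanSpace ℝ (Fin 3))
      = |((i : ℕ) : ℝ) - ((j : ℕ) : ℝ)| := by
  rw [EuclideanSpace.dist_eq, Fin.sum_univ_three]
  simp [Real.dist_eq, sq_abs, Real.sqrt_sq_eq_abs]

/-- LOAD-BEARING ratio bound: with `ρ ≤ 57/50·d` dropped the crux is false (fourteen collinear
points at unit spacing, `d = 1`, `ρ = 13`: everyone sees all 13 others). [folklore] -/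
theorem averagedTwelve_false_without_ratio :
    ¬ (∀ (N : ℕ) (x : Fin N → EuclideanSpace ℝ (Fin 3)) (G : Finset (Fin N)) (d ρ : ℝ),
        0 < d → (∀ i ∈ G, ∀ j ∈ G, i ≠ j → d ≤ dist (x i) (x j)) →
        (∑ i ∈ G, ((G.filter fun j => j ≠ i ∧ dist (x i) (x j) ≤ ρ).card : ℝ)) ≤ 12 * G.card) := by
  intro H
  have hsep : ∀ i ∈ (Finset.univ : Finset (Fin 14)), ∀ j ∈ (Finset.univ : Finset (Fin 14)), i ≠ j →
      (1 : ℝ) ≤ dist ((fun k : Fin 14 => (WithLp.toLp 2 ![((k : ℕ) : ℝ), 0, 0] : EuclideanSpace ℝ (Fin 3))) i)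
        ((fun k : Fin 14 => (WithLp.toLp 2 ![((k : ℕ) : ℝ), 0, 0] : EuclideanSpace ℝ (Fin 3))) j) := by
    intro i _ j _ hij
    beta_reduce
    rw [dist_collinear]
    have hne : (i : ℕ) ≠ (j : ℕ) := Fin.val_ne_of_ne hij
    rcases Nat.lt_or_gt_of_ne hne with hlt | hlt
    · have : ((i : ℕ) : ℝ) + 1 ≤ ((j : ℕ) : ℝ) := by exact_mod_cast hlt
      rw [abs_sub_comm]
      exact le_abs.mpr (Or.inl (by linarith))
    · have : ((j : ℕ) : ℝ) + 1 ≤ ((i : ℕ) : ℝ) := by exact_mod_cast hlt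
      exact le_abs.mpr (Or.inl (by linarith))
  have h := H 14 (fun k : Fin 14 => (WithLp.toLp 2 ![((k : ℕ) : ℝ), 0, 0] : EuclideanSpace ℝ (Fin 3)))
    Finset.univ 1 13 (by norm_num) hsep
  beta_reduce at h
  have hfilt : ∀ i : Fin 14, ((Finset.univ : Finset (Fin 14)).filter fun j => j ≠ i ∧
        dist (WithLp.toLp 2 ![((i : ℕ) : ℝ), 0, 0] : EuclideanSpace ℝ (Fin 3))
             (WithLp.toLp 2 ![((j : ℕ) : ℝ), 0, 0] : EuclideanSpace ℝ (Fin 3)) ≤ 13) = Finset.univ.erase i := by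
    intro i
    ext j
    simp only [Finset.mem_filter, Finset.mem_univ, true_and, Finset.mem_erase, and_true]
    constructor
    · exact fun hx => hx.1
    · intro hji
      refine ⟨hji, ?_⟩
      rw [dist_collinear]
      have hi : ((i : ℕ) : ℝ) ≤ 13 := by exact_mod_cast Nat.lt_succ_iff.mp i.isLt
      have hj : ((j : ℕ) : ℝ) ≤ 13 := by exact_mod_cast Nat.lt_succ_iff.mp j.isLt
      have hi0 : (0 : ℝ) ≤ ((i : ℕ) : ℝ) := by positivity
      have hj0 : (0 : ℝ) ≤ ((j : ℕ) : ℝ) := by positivity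
      exact abs_sub_le_iff.mpr ⟨by linarith, by linarith⟩
  simp_rw [hfilt, Finset.card_erase_of_mem (Finset.mem_univ _), Finset.card_univ, Fintype.card_fin] at h
  simp at h
  norm_num at h

/-! ## §2 Integer-coordinate reduction -/

/-- The Euclidean distance of two integer points is the square root of the integer squared distance.
[folklore] -/
theorem dist_intPt (p q : Fin 3 → ℤ) :
    dist (WithLp.toLp 2 ![((p 0 : ℤ) : ℝ), ((p 1 : ℤ) : ℝ), ((p 2 : ℤ) : ℝ)] : EuclideanSpace ℝ (Fin 3))
         (WithLp.toLp 2 ![((q 0 : ℤ) : ℝ), ((q 1 : ℤ) : ℝ), ((q 2 : ℤ) : ℝ)] : EuclideanSpace ℝ (Fin 3))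
      = Real.sqrt ((((p 0 - q 0) ^ 2 + (p 1 - q 1) ^ 2 + (p 2 - q 2) ^ 2 : ℤ) : ℤ) : ℝ) := by
  rw [EuclideanSpace.dist_eq, Fin.sum_univ_three]
  simp only [Real.dist_eq, sq_abs]
  push_cast
  congr 1

/-- `√D ≤ dist` iff `D ≤` the integer squared distance. [folklore] -/
theorem sqrt_le_dist_intPt_iff (p q : Fin 3 → ℤ) (D : ℤ) :
    Real.sqrt D ≤
      dist (WithLp.toLp 2 ![((p 0 : ℤ) : ℝ), ((p 1 : ℤ) : ℝ), ((p 2 : ℤ) : ℝ)] : EuclideanSpace ℝ (Fin 3))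
           (WithLp.toLp 2 ![((q 0 : ℤ) : ℝ), ((q 1 : ℤ) : ℝ), ((q 2 : ℤ) : ℝ)] : EuclideanSpace ℝ (Fin 3))
      ↔ D ≤ (p 0 - q 0) ^ 2 + (p 1 - q 1) ^ 2 + (p 2 - q 2) ^ 2 := by
  rw [dist_intPt, Real.sqrt_le_sqrt_iff (by positivity)]
  exact_mod_cast Iff.rfl

/-- `dist ≤ M` iff the integer squared distance is `≤ M²` (`M ≥ 0`). [folklore] -/
theorem dist_intPt_le_iff (p q : Fin 3 → ℤ) (M : ℤ) (hM : 0 ≤ M) :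
    dist (WithLp.toLp 2 ![((p 0 : ℤ) : ℝ), ((p 1 : ℤ) : ℝ), ((p 2 : ℤ) : ℝ)] : EuclideanSpace ℝ (Fin 3))
         (WithLp.toLp 2 ![((q 0 : ℤ) : ℝ), ((q 1 : ℤ) : ℝ), ((q 2 : ℤ) : ℝ)] : EuclideanSpace ℝ (Fin 3)) ≤ M
      ↔ (p 0 - q 0) ^ 2 + (p 1 - q 1) ^ 2 + (p 2 - q 2) ^ 2 ≤ M ^ 2 := by
  rw [dist_intPt, Real.sqrt_le_left (by exact_mod_cast hM)]
  exact_mod_cast Iff.rfl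

/-- REFUTATION SHAPE (integer reduction).  A configuration `pts` with integer coordinates, pairwise
squared distances `≥ D > 0`, an integer radius `0 ≤ M ≤ c·√D`, and more than `12 N` ordered pairs at
squared distance `≤ M²` refutes the crux at ratio constant `c` (realised by the points
`(pts i 0, pts i 1, pts i 2) ∈ ℝ³`, `d = √D`, `ρ = M`, `G = univ`).  All hypotheses except `hcM` are
decidable integer facts. [folklore] -/
theorem not_averagedTwelveAt_of_intConfig (c : ℝ) {N : ℕ} (pts : Fin N → Fin 3 → ℤ) (D M : ℤ)
    (hD : 0 < D) (hM : 0 ≤ M) (hcM : (M : ℝ) ≤ c * Real.sqrt D)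
    (hsep : ∀ i j : Fin N, i ≠ j →
      D ≤ (pts i 0 - pts j 0) ^ 2 + (pts i 1 - pts j 1) ^ 2 + (pts i 2 - pts j 2) ^ 2)
    (hcount : 12 * N < ∑ i : Fin N, ((Finset.univ.filter fun j : Fin N => j ≠ i ∧
      (pts i 0 - pts j 0) ^ 2 + (pts i 1 - pts j 1) ^ 2 + (pts i 2 - pts j 2) ^ 2 ≤ M ^ 2).card)) :
    ¬ (∀ (N : ℕ) (x : Fin N → EuclideanSpace ℝ (Fin 3)) (G : Finset (Fin N)) (d ρ : ℝ),
        0 < d → ρ ≤ c * d → (∀ i ∈ G, ∀ j ∈ G, i ≠ j → d ≤ dist (x i) (x j)) →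
        (∑ i ∈ G, ((G.filter fun j => j ≠ i ∧ dist (x i) (x j) ≤ ρ).card : ℝ)) ≤ 12 * G.card) := by
  intro H
  have hsep' : ∀ i ∈ (Finset.univ : Finset (Fin N)), ∀ j ∈ (Finset.univ : Finset (Fin N)), i ≠ j →
      Real.sqrt D ≤ dist
        ((fun k : Fin N => (WithLp.toLp 2 ![((pts k 0 : ℤ) : ℝ), ((pts k 1 : ℤ) : ℝ), ((pts k 2 : ℤ) : ℝ)] :
          EuclideanSpace ℝ (Fin 3))) i)
        ((fun k : Fin N => (WithLp.toLp 2 ![((pts k 0 : ℤ) : ℝ), ((pts k 1 : ℤ) : ℝ), ((pts k 2 : ℤ) : ℝ)] :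
          EuclideanSpace ℝ (Fin 3))) j) :=
    fun i _ j _ hij => (sqrt_le_dist_intPt_iff (pts i) (pts j) D).mpr (hsep i j hij)
  have h := H N
    (fun k : Fin N => (WithLp.toLp 2 ![((pts k 0 : ℤ) : ℝ), ((pts k 1 : ℤ) : ℝ), ((pts k 2 : ℤ) : ℝ)] :
      EuclideanSpace ℝ (Fin 3)))
    Finset.univ (Real.sqrt D) M (Real.sqrt_pos.mpr (by exact_mod_cast hD)) hcM hsep'
  beta_reduce at h
  have hfilt : ∀ i : Fin N, ((Finset.univ : Finset (Fin N)).filter fun j : Fin N => j ≠ i ∧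
        dist (WithLp.toLp 2 ![((pts i 0 : ℤ) : ℝ), ((pts i 1 : ℤ) : ℝ), ((pts i 2 : ℤ) : ℝ)] :
                EuclideanSpace ℝ (Fin 3))
             (WithLp.toLp 2 ![((pts j 0 : ℤ) : ℝ), ((pts j 1 : ℤ) : ℝ), ((pts j 2 : ℤ) : ℝ)] :
                EuclideanSpace ℝ (Fin 3)) ≤ (M : ℝ))
      = (Finset.univ.filter fun j : Fin N => j ≠ i ∧
          (pts i 0 - pts j 0) ^ 2 + (pts i 1 - pts j 1) ^ 2 + (pts i 2 - pts j 2) ^ 2 ≤ M ^ 2) := by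
    intro i
    apply Finset.filter_congr
    intro j _
    rw [dist_intPt_le_iff (pts i) (pts j) M hM]
  simp_rw [hfilt, Finset.card_univ, Fintype.card_fin] at h
  have hc : ((12 * N : ℕ) : ℝ) <
      ((∑ i : Fin N, ((Finset.univ.filter fun j : Fin N => j ≠ i ∧
        (pts i 0 - pts j 0) ^ 2 + (pts i 1 - pts j 1) ^ 2 + (pts i 2 - pts j 2) ^ 2 ≤ M ^ 2).card) : ℕ) : ℝ) := by
    exact_mod_cast hcount
  push_cast at hc
  linarith

/-! ## §3 The pointwise strengthening is false at ratio 57/50 -/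

/-- The pointwise form implies the averaged form (so it IS a strengthening of the crux; stated for a
general constant `c`, conclusion spelled out). [folklore] -/
theorem averaged_of_pointwise (c : ℝ)
    (H : ∀ (N : ℕ) (x : Fin N → EuclideanSpace ℝ (Fin 3)) (G : Finset (Fin N)) (d ρ : ℝ),
        0 < d → ρ ≤ c * d → (∀ i ∈ G, ∀ j ∈ G, i ≠ j → d ≤ dist (x i) (x j)) →
        ∀ i ∈ G, ((G.filter fun j => j ≠ i ∧ dist (x i) (x j) ≤ ρ).card) ≤ 12)
    (N : ℕ) (x : Fin N → EuclideanSpace ℝ (Fin 3)) (G : Finset (Fin N)) (d ρ : ℝ)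
    (hd : 0 < d) (hρ : ρ ≤ c * d) (hsep : ∀ i ∈ G, ∀ j ∈ G, i ≠ j → d ≤ dist (x i) (x j)) :
    (∑ i ∈ G, ((G.filter fun j => j ≠ i ∧ dist (x i) (x j) ≤ ρ).card : ℝ)) ≤ 12 * G.card := by
  have hle : ∀ i ∈ G, (((G.filter fun j => j ≠ i ∧ dist (x i) (x j) ≤ ρ).card : ℕ) : ℝ) ≤ 12 := by
    intro i hi
    exact_mod_cast H N x G d ρ hd hρ hsep i hi
  calc (∑ i ∈ G, ((G.filter fun j => j ≠ i ∧ dist (x i) (x j) ≤ ρ).card : ℝ))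
      ≤ ∑ i ∈ G, (12 : ℝ) := Finset.sum_le_sum hle
    _ = 12 * G.card := by rw [Finset.sum_const, nsmul_eq_mul, mul_comm]

/-- The POINTWISE strengthening of the crux (every centre has ≤ 12 ρ-neighbours) is FALSE at ratio
57/50.  Witness (in the proof): 15 integer points — centre `(0,0,0)`, poles `(0,0,±22)`, the ring
`(20,0,9), (±10,±17,9), (-20,0,9)` and the staggered ring `(±17,±10,-9), (0,±20,-9)` (bicapped
staggered hexagonal arrangement, scale 20, radius ≈ 1.1·d): all pairs have squared distance ≥ 389 and
the centre has 14 others within squared distance 484 = 22² ≤ (57/50)²·389 (kernel `decide`); with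
`d = √389`, `ρ = 22` the centre has 14 > 12 neighbours.  Any proof of `AveragedTwelve` must average
over centres; no one-centre inequality suffices on (1.0456, 1.14]. [folklore] -/
theorem not_averagedTwelve_pointwise :
    ¬ (∀ (N : ℕ) (x : Fin N → EuclideanSpace ℝ (Fin 3)) (G : Finset (Fin N)) (d ρ : ℝ),
        0 < d → ρ ≤ 57 / 50 * d → (∀ i ∈ G, ∀ j ∈ G, i ≠ j → d ≤ dist (x i) (x j)) →
        ∀ i ∈ G, ((G.filter fun j => j ≠ i ∧ dist (x i) (x j) ≤ ρ).card) ≤ 12) := by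
  intro H
  obtain ⟨W, hW⟩ : ∃ W : Fin 15 → Fin 3 → ℤ, W =
      ![![0, 0, 0], ![0, 0, 22], ![0, 0, -22], ![20, 0, 9], ![10, 17, 9], ![-10, 17, 9], ![-20, 0, 9],
        ![-10, -17, 9], ![10, -17, 9], ![17, 10, -9], ![0, 20, -9], ![-17, 10, -9], ![-17, -10, -9],
        ![0, -20, -9], ![17, -10, -9]] := ⟨_, rfl⟩
  have hWsep : ∀ i j : Fin 15, i ≠ j →
      (389 : ℤ) ≤ (W i 0 - W j 0) ^ 2 + (W i 1 - W j 1) ^ 2 + (W i 2 - W j 2) ^ 2 := by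
    subst hW
    decide
  have hWcount : ((Finset.univ.filter fun j : Fin 15 => j ≠ 0 ∧
      (W 0 0 - W j 0) ^ 2 + (W 0 1 - W j 1) ^ 2 + (W 0 2 - W j 2) ^ 2 ≤ (22 : ℤ) ^ 2).card) = 14 := by
    subst hW
    decide
  have hcM : ((22 : ℤ) : ℝ) ≤ 57 / 50 * Real.sqrt ((389 : ℤ) : ℝ) := by
    have h1 : (1100 / 57 : ℝ) ≤ Real.sqrt 389 := (Real.le_sqrt' (by norm_num)).mpr (by norm_num)
    push_cast
    linarith
  have hsep' : ∀ i ∈ (Finset.univ : Finset (Fin 15)), ∀ j ∈ (Finset.univ : Finset (Fin 15)), i ≠ j →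
      Real.sqrt ((389 : ℤ) : ℝ) ≤ dist
        ((fun k : Fin 15 => (WithLp.toLp 2 ![((W k 0 : ℤ) : ℝ), ((W k 1 : ℤ) : ℝ), ((W k 2 : ℤ) : ℝ)] :
          EuclideanSpace ℝ (Fin 3))) i)
        ((fun k : Fin 15 => (WithLp.toLp 2 ![((W k 0 : ℤ) : ℝ), ((W k 1 : ℤ) : ℝ), ((W k 2 : ℤ) : ℝ)] :
          EuclideanSpace ℝ (Fin 3))) j) :=
    fun i _ j _ hij => (sqrt_le_dist_intPt_iff (W i) (W j) 389).mpr (hWsep i j hij)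
  have h := H 15
    (fun k : Fin 15 => (WithLp.toLp 2 ![((W k 0 : ℤ) : ℝ), ((W k 1 : ℤ) : ℝ), ((W k 2 : ℤ) : ℝ)] :
      EuclideanSpace ℝ (Fin 3)))
    Finset.univ (Real.sqrt ((389 : ℤ) : ℝ)) ((22 : ℤ) : ℝ) (Real.sqrt_pos.mpr (by norm_num)) hcM hsep'
    0 (Finset.mem_univ _)
  beta_reduce at h
  have hfilt : ((Finset.univ : Finset (Fin 15)).filter fun j : Fin 15 => j ≠ 0 ∧
        dist (WithLp.toLp 2 ![((W 0 0 : ℤ) : ℝ), ((W 0 1 : ℤ) : ℝ), ((W 0 2 : ℤ) : ℝ)] : EuclideanSpace ℝ (Fin 3))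
             (WithLp.toLp 2 ![((W j 0 : ℤ) : ℝ), ((W j 1 : ℤ) : ℝ), ((W j 2 : ℤ) : ℝ)] : EuclideanSpace ℝ (Fin 3))
          ≤ ((22 : ℤ) : ℝ))
      = (Finset.univ.filter fun j : Fin 15 => j ≠ 0 ∧
          (W 0 0 - W j 0) ^ 2 + (W 0 1 - W j 1) ^ 2 + (W 0 2 - W j 2) ^ 2 ≤ (22 : ℤ) ^ 2) := by
    apply Finset.filter_congr
    intro j _
    rw [dist_intPt_le_iff (W 0) (W j) 22 (by norm_num)]
  rw [hfilt, hWcount] at h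
  omega

end Summit.AtomisticToContinuum.Crystallization.Theorems.AveragedTwelveNegative
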